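/-
Copyright (c) 2026 the pub-hodgecm-mathlib formalisation cell (harness21).  Prover seat hodgecm-mathlib-K2Liu-p10 (g4), Track B «K2-LIT»,
#184♮ = hLiu418 = `stmt-HodgeConjecture-24832`; (σ) endgame organ, sockets σ-3∕σ-4 of ★∕📤 I-4b `faceA4R_two_of_record`: `|det_Δ| = 1` on compact Levi subgroups; `hK₁χ`.
-/
import Summits.HodgeConjecture.HodgeConjecture.Theorems.K2LiuLeviCharacterFromSiegelLaw        -- ★ (L3-a) p860731
import Summits.HodgeConjecture.HodgeConjecture.Theorems.K2LiuSiegelCharacterUnramifiedShift    -- ★ (L3-b) p860746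
import Summits.HodgeConjecture.HodgeConjecture.Theorems.K2LiuLocalSiegelCharacterMul           -- ★ `detDelta_mul`, `isUnit_detDelta`, `absDetDelta_mul`
import Literature.NumberTheory.GelbartRogawski1991.LocalDoubledUnitarySmooth                   -- ★ `continuous_detDeltaGL`, `detDelta_eq_detDeltaGL`
import Mathlib.Analysis.SpecificLimits.Basic
import HarnessLib

/-!
# Crux `HLiu418`, (σ) endgame, sockets σ-3∕σ-4: `|det_Δ|_w = 1` ON EVERY COMPACT SUBGROUP OF THE SIEGEL LEVI, AND V8e's `hK₁χ` ∕ `ha₀` ASSEMBLED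

Cell `hodgecm-mathlib`, crux item hLiu418 = `stmt-HodgeConjecture-24832`, route of record `HCCMUnconditional`; squad K2 ∕ K2Liu, prover K2Liu-p10 (g4).
THEOREMS ONLY; lane `--supports stmt-HodgeConjecture-24832 --as helper`.  V8e ∕ ★ K2Lit currency `(F E c hcδ hδ hd v n hT₀ hJD)`.

* §1 **`norm_detDelta_eq_one_of_isCompact`**: for a continuous hom `mΔ : Γ₁ →* H_v` into Siegel elements and a subgroup `K₁ ≤ Γ₁` with `IsCompact K₁`, every `‖det_Δ,w (mΔ a)‖ = 1`
  (`a ↦ ‖det_Δ,w (mΔ a)‖` is a continuous multiplicative map into `ℝ_{>0}` — ★ `detDelta_mul`, ★ `continuous_detDeltaGL` — and a bounded subgroup of `ℝ_{>0}` is trivial: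
  `r^m → ∞`); **`absDetDelta_eq_one_of_isCompact`**.
* §2 **`hK₁χ_of_laws`** = the socket `hK₁χ` of 📤 I-4b (universal in `cM`): from V8e's `ω 𝒜 h𝒜` + the instance one-liners `h𝒜1 : 𝒜 Ψ 1 = κ Ψ 0` (`κ ≠ 0`), `hΦ`, a compact
  `K₁`, an `a₀` with `absDetDelta (mΔ a₀) ≠ 1`, unitary `χv χv′` agreeing on `mΔ(K₁)` (`hχeq : chiDet χv′ (mΔ a) = chiDet χv (mΔ a)`, e.g. `χv′ = χv` by conjugate self-duality):
  for EVERY `cM` with `hM`, `(∀ a ∈ K₁, cM a = localSiegelCharacter χv′ (−½) (mΔ a)) ∧ cM a₀ ≠ localSiegelCharacter χv′ (−½) (mΔ a₀)`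
  (★ (L3-a) `cM = localSiegelCharacter χv (½) ∘ mΔ`; §1; ★ (L3-b) `localSiegelCharacter_half_ne_neg_half`).

HONEST LABEL: HC_CM is proved only modulo the 7 printed citations (2 remaining named inputs: hLiu418 = stmt-HodgeConjecture-24832, h413 = stmt-HodgeConjecture-24833)
until rung 0 closes; helper, closes no item.
References: [HarrisKudlaSweet1996] §1 (1.15)–(1.16); [Kudla1994] §3; [WeilBNT1967] Ch. I §2 (compact subgroups of `ℝ_{>0}^×`).
-/

set_option autoImplicit false
set_option linter.dupNamespace false -- the mandated namespace repeats `HodgeConjecture.HodgeConjecture`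

noncomputable section

open scoped Matrix Topology
open Filter NumberField IsDedekindDomain
open Literature.NumberTheory.Automorphic Literature.NumberTheory.Automorphic.UnitaryGroup
open Literature.NumberTheory.GelbartRogawski1991.UnitaryDualPair.LocalSplitting
open Literature.NumberTheory.K2Lit.LocalSiegelDoubled
open Literature.RepresentationTheory.HeisenbergGroup
open Summit.HodgeConjecture.HodgeConjecture.Cruxes.HLiu418.K2LiuLocalSiegel
open Summit.HodgeConjecture.HodgeConjecture.Cruxes.HLiu418.K2LiuLeviCharacterFromSiegelLaw
open Summit.HodgeConjecture.HodgeConjecture.Cruxes.HLiu418.K2LiuSiegelCharacterUnramifiedShift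

namespace Summit.HodgeConjecture.HodgeConjecture.Cruxes.HLiu418.K2LiuA7ValueSocketLevi

variable (F : Type) [Field F] [NumberField F] (E : Type) [Field E] [NumberField E] [Algebra F E]
  [Algebra.IsQuadraticExtension F E] (c : E ≃ₐ[F] E)
  {δ : E} (hcδ : c δ = -δ) (hδ : δ ≠ 0) {d : F} (hd : δ * δ = algebraMap F E d) (v : HeightOneSpectrum (𝓞 F)) (n : ℕ)
  {T₀ : Matrix (Fin n) (Fin n) F} (hT₀ : T₀.IsSymm)
  {JD : Matrix (Fin (n + n)) (Fin (n + n)) E} (hJD : JD = (gramD F n T₀).map (algebraMap F E))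
  {Γ₁ : Type} [Group Γ₁] [TopologicalSpace Γ₁]
  (mΔ : Γ₁ →* UnitaryGroup.localPi E c (n + n) JD v) (hmc : Continuous mΔ) (hmΔ : ∀ a, IsSiegelDelta F E c hcδ hδ hd v n hT₀ hJD (mΔ a))

/-! ## §1 `|det_Δ|_w = 1` on compact Levi subgroups -/

/-- a bounded-above multiplicative map `g : K → ℝ` on a group with `g 1 = 1`, `g (a b) = g a g b`, `0 < g` is identically `1`. [folklore] -/
theorem eq_one_of_mul_of_bddAbove {K : Type*} [Group K] (g : K → ℝ) (hpos : ∀ a, 0 < g a) (hmul : ∀ a b, g (a * b) = g a * g b)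
    (hbdd : ∃ M, ∀ a, g a ≤ M) (a : K) : g a = 1 := by
  obtain ⟨M, hM⟩ := hbdd
  have hpow : ∀ (b : K) (m : ℕ), g (b ^ m) = g b ^ m := fun b m => by
    induction m with
    | zero =>
      rw [pow_zero, pow_zero]
      have h1 : g 1 * g 1 = g 1 := by rw [← hmul, one_mul]
      exact (mul_right_eq_self₀.1 h1).resolve_right (hpos 1).ne'
    | succ m ih => rw [pow_succ, hmul, ih, pow_succ]
  -- no value exceeds `1`: else its powers are unbounded
  have hle : ∀ b, g b ≤ 1 := fun b => by
    by_contra h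
    push Not at h
    obtain ⟨m, hm⟩ := (tendsto_pow_atTop_atTop_of_one_lt h).eventually_gt_atTop M |>.exists
    exact absurd (hM (b ^ m)) (by rw [hpow]; exact not_le.2 hm)
  -- and `g a⁻¹ = (g a)⁻¹ ≤ 1`
  have hinv : g a⁻¹ * g a = 1 := by
    rw [← hmul, inv_mul_cancel]
    have h1 : g 1 * g 1 = g 1 := by rw [← hmul, one_mul]
    exact (mul_right_eq_self₀.1 h1).resolve_right (hpos 1).ne'
  have h2 : 1 ≤ g a := by
    have := hle a⁻¹
    rw [← hinv]
    calc g a⁻¹ * g a ≤ 1 * g a := by gcongr; exact (hpos a).le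
      _ = g a := one_mul _
  exact le_antisymm (hle a) h2

omit [Algebra.IsQuadraticExtension F E] in
include hmc in
/-- `a ↦ det_Δ,w (mΔ a)` is continuous. [cite: Kudla1994, §3] -/
theorem continuous_detDelta_comp (w : PlacesOver E v) : Continuous fun a : Γ₁ => detDelta F E c v n w (mΔ a) := by
  have h1 : Continuous fun a : Γ₁ => ((mΔ a : UnitaryGroup.LocalGLPi E (n + n) v) w) :=
    (continuous_apply w).comp (continuous_subtype_val.comp hmc)
  exact (continuous_detDeltaGL F E v n w).comp h1

include hmc hmΔ in
/-- **`‖det_Δ,w (mΔ a)‖ = 1` FOR `a` IN A COMPACT SUBGROUP `K₁`** of the Levi. [cite: HarrisKudlaSweet1996, §1 (1.15)] [cite: WeilBNT1967, Ch. I §2] -/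
theorem norm_detDelta_eq_one_of_isCompact (K₁ : Subgroup Γ₁) (hK₁ : IsCompact (K₁ : Set Γ₁)) (a : Γ₁) (ha : a ∈ K₁) (w : PlacesOver E v) :
    ‖detDelta F E c v n w (mΔ a)‖ = 1 := by
  let g : K₁ → ℝ := fun b => ‖detDelta F E c v n w (mΔ (b : Γ₁))‖
  have hpos : ∀ b : K₁, 0 < g b := fun b => norm_pos_iff.2 (isUnit_detDelta F E c hcδ hδ hd v n hT₀ hJD _ (hmΔ _) w).ne_zero
  have hmul : ∀ b b' : K₁, g (b * b') = g b * g b' := fun b b' => by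
    simp only [g, Subgroup.coe_mul, map_mul, detDelta_mul F E c hcδ hδ hd v n hT₀ hJD _ _ (hmΔ _) w, norm_mul]
  have hcont : Continuous g := (continuous_norm.comp (continuous_detDelta_comp F E c v n mΔ hmc w)).comp continuous_subtype_val
  have hbdd : ∃ M, ∀ b : K₁, g b ≤ M := by
    haveI : CompactSpace K₁ := isCompact_iff_compactSpace.1 hK₁
    obtain ⟨M, hM⟩ := (isCompact_univ.image hcont).isBounded.bddAbove
    exact ⟨M, fun b => hM ⟨b, Set.mem_univ _, rfl⟩⟩
  exact eq_one_of_mul_of_bddAbove g hpos hmul hbdd ⟨a, ha⟩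

include hmc hmΔ in
/-- **`|det_Δ (mΔ a)|_v = 1` on a compact `K₁`**. [cite: HarrisKudlaSweet1996, §1 (1.15)] -/
theorem absDetDelta_eq_one_of_isCompact (K₁ : Subgroup Γ₁) (hK₁ : IsCompact (K₁ : Set Γ₁)) (a : Γ₁) (ha : a ∈ K₁) :
    absDetDelta F E c v n (mΔ a) = 1 :=
  absDetDelta_eq_one_of_norm_detDelta_eq_one F E c v n (mΔ a) fun w => norm_detDelta_eq_one_of_isCompact F E c hcδ hδ hd v n hT₀ hJD mΔ hmc hmΔ K₁ hK₁ a ha w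

omit [TopologicalSpace Γ₁] in
include hmΔ in
/-- `0 < |det_Δ (mΔ a)|_v` (Siegel elements have unit `det_Δ`). [cite: Kudla1994, §3] -/
theorem absDetDelta_pos (a : Γ₁) : 0 < absDetDelta F E c v n (mΔ a) :=
  Finset.prod_pos fun w _ => norm_pos_iff.2 (isUnit_detDelta F E c hcδ hδ hd v n hT₀ hJD _ (hmΔ a) w).ne_zero

omit [Algebra.IsQuadraticExtension F E] in
/-- with `|det_Δ p|_v = 1` the Siegel character is `χ_v(det_Δ p)` for every `s`. [cite: HarrisKudlaSweet1996, §1 (1.15)] -/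
theorem localSiegelCharacter_of_absDetDelta_eq_one (χv : ∀ w : PlacesOver E v, (w.1.adicCompletion E)ˣ →* ℂˣ) (s : ℂ)
    (p : UnitaryGroup.localPi E c (n + n) JD v) (hp : absDetDelta F E c v n p = 1) :
    localSiegelCharacter F E c v n χv s p = ((chiDet F E c v n χv p : ℂˣ) : ℂ) := by
  unfold localSiegelCharacter
  rw [hp, Complex.ofReal_one, Complex.one_cpow, mul_one]

/-! ## §2 The socket `hK₁χ` (universal in `cM`) -/

include hmc hmΔ in
/-- **V8e's `hK₁χ` ∕ `ha₀` AT ONCE (the socket of 📤 I-4b, universal in `cM`)**. [cite: HarrisKudlaSweet1996, §1 (1.15)–(1.16)] [cite: Kudla1994, §3 Thm. 3.1] -/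
theorem hK₁χ_of_laws (χv χv' : ∀ w : PlacesOver E v, (w.1.adicCompletion E)ˣ →* ℂˣ)
    (hχu : ∀ (w : PlacesOver E v) (u : (w.1.adicCompletion E)ˣ), ‖((χv w u : ℂˣ) : ℂ)‖ = 1)
    (hχu' : ∀ (w : PlacesOver E v) (u : (w.1.adicCompletion E)ˣ), ‖((χv' w u : ℂˣ) : ℂ)‖ = 1)
    {ιX : Type}
    (ω : UnitaryGroup.localPi E c (n + n) JD v → SchwartzBruhat (ιX → v.adicCompletion F) →ₗ[ℂ] SchwartzBruhat (ιX → v.adicCompletion F))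
    (𝒜 : SchwartzBruhat (ιX → v.adicCompletion F) →ₗ[ℂ] ↥(localDegPS F E c hcδ hδ hd v n hT₀ hJD χv (1 / 2)))
    (h𝒜 : ∀ (u : UnitaryGroup.localPi E c (n + n) JD v) (Φ : SchwartzBruhat (ιX → v.adicCompletion F)) (x : UnitaryGroup.localPi E c (n + n) JD v),
      ((𝒜 (ω u Φ) : ↥(localDegPS F E c hcδ hδ hd v n hT₀ hJD χv (1 / 2))) : UnitaryGroup.localPi E c (n + n) JD v → ℂ) x =
        ((𝒜 Φ : ↥(localDegPS F E c hcδ hδ hd v n hT₀ hJD χv (1 / 2))) : UnitaryGroup.localPi E c (n + n) JD v → ℂ) (x * u))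
    {κ : ℂ} (hκ : κ ≠ 0)
    (h𝒜1 : ∀ Ψ : SchwartzBruhat (ιX → v.adicCompletion F),
      ((𝒜 Ψ : ↥(localDegPS F E c hcδ hδ hd v n hT₀ hJD χv (1 / 2))) : UnitaryGroup.localPi E c (n + n) JD v → ℂ) 1 = κ * (Ψ : (ιX → v.adicCompletion F) → ℂ) 0)
    (hΦ : ∃ Φ : SchwartzBruhat (ιX → v.adicCompletion F), (Φ : (ιX → v.adicCompletion F) → ℂ) 0 ≠ 0)
    (aX : Γ₁ →* ((ιX → v.adicCompletion F) ≃ₗ[v.adicCompletion F] (ιX → v.adicCompletion F)))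
    (haXc : ∀ a, Continuous (aX a)) (haXc' : ∀ a, Continuous (aX a).symm)
    (K₁ : Subgroup Γ₁) (hK₁ : IsCompact (K₁ : Set Γ₁))
    (hχeq : ∀ a ∈ K₁, chiDet F E c v n χv' (mΔ a) = chiDet F E c v n χv (mΔ a))
    (a₀ : Γ₁) (ha₀ : absDetDelta F E c v n (mΔ a₀) ≠ 1)
    (cM : Γ₁ →* ℂˣ)
    (hM : ∀ (a : Γ₁) (Φ : SchwartzBruhat (ιX → v.adicCompletion F)), ω (mΔ a) Φ = (cM a : ℂ) • leviEquivSB (aX a) (haXc a) (haXc' a) Φ) :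
    (∀ a ∈ K₁, (cM a : ℂ) = localSiegelCharacter F E c v n χv' (-(1 / 2)) (mΔ a)) ∧
      (cM a₀ : ℂ) ≠ localSiegelCharacter F E c v n χv' (-(1 / 2)) (mΔ a₀) := by
  have hcM := coe_cM_eq_localSiegelCharacter F E c hcδ hδ hd v n hT₀ hJD χv (1 / 2) ω 𝒜 h𝒜 hκ h𝒜1 hΦ mΔ hmΔ aX haXc haXc' cM hM
  refine ⟨fun a ha => ?_, ?_⟩
  · have h1 := absDetDelta_eq_one_of_isCompact F E c hcδ hδ hd v n hT₀ hJD mΔ hmc hmΔ K₁ hK₁ a ha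
    rw [hcM, localSiegelCharacter_of_absDetDelta_eq_one F E c v n χv _ _ h1, localSiegelCharacter_of_absDetDelta_eq_one F E c v n χv' _ _ h1, hχeq a ha]
  · rw [hcM]
    exact localSiegelCharacter_half_ne_neg_half F E c v n χv χv' hχu hχu' (mΔ a₀) (absDetDelta_pos F E c hcδ hδ hd v n hT₀ hJD mΔ hmΔ a₀) ha₀

end Summit.HodgeConjecture.HodgeConjecture.Cruxes.HLiu418.K2LiuA7ValueSocketLevi

end
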